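import Mathlib
import Summits.Ventures.PercRepro2.HCov
import Summits.Ventures.PercRepro2.BHKAvoid
import Summits.Ventures.PercRepro2.ExploreA3
import Summits.Ventures.PercRepro2.RootLeafUSigns
import Summits.Ventures.PercRepro2.RootLeafUHalf

/-!
# (G4-u): the sign structure of the halves of the second coefficient — `B ≤ 0`, the mirror core
vanishes, and the negative term of `T2oL` is dominated by its `A`-term (blind cell PercRepro2,
p4 g6; proofs/P4-G6-OU.md §1, §3a)

With the coefficients `α, β, κ` of RootLeafUHalf (`A := α + κ`, `B := α − κ`), the masses
`Z = P(Q)`, `D = P(PD)`, `t = P(T)`, `t′ = P(T′)`, `W = P(R) = D + t` (`R = {u ↮ a₂, u ↮ c}`),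
`hb = P(a₂ ↔ b)`, `d0 = P(a₂ ↮ c)`:

* **`prob_Tp_bK_le`**: `P(T′, b ∈ K) ≤ hb · t′` — BHK06 Thm 1.4 (`c ∈ L` against `b ∈ K`) and Harris.
* **`B_nonpos`**: `α − κ ≤ 0` ALWAYS (`B/2 = P(T′, bK) − hb·t′ − P(Q, bL, c ∉ K)`), so the second
  coefficient of `T2oL`'s exploration form is never positive.
* **`T2oK_root_eq_zero`**: the `o ∈ K` half at `o := a₂` vanishes identically — the mirror of the
  o-free core `(OU)` of RootLeafUOu is zero; the `o ∈ K` half is a pure correlation.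
* **`Sigma_nonneg`**: `2β · P(R, b ∈ K) ≤ A · W` (the coefficient of the `c ∉ L` row after BHK):
  `A·W/2 − β·P(R,bK) = (W·hb − P(R,bK))·D + (W·hb − d0·P(R,bK))·t′ + (1−d0)·W·[P(T′,bL) − P(T′,bK)]
  + W·[(1−d0)·P(R,bL) − P(T,bL)]`, each piece non-negative (Harris, the tower bound, `prob_Tp_bK_le`).
* **`negterm_le`**: `2β · P(Q, o ∈ L, c ∉ L, b ∈ K) ≤ A · P(Q, o ∈ L, c ∉ L)` — BHK06 Thm 1.4 with
  the avoided set `{a₂, c}` (`bhk_cross_cluster_avoid`) and `Sigma_nonneg`: the whole negative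
  term of `T2oL` is dominated by its `A`-term; hence
* **`T2oL_ge_cK_row`**: `T2oL ≥ (α − κ)·P(T, oL) + 2β·P(T, oL, bL)` — what is left of the sign
  `0 ≤ T2oL` is the `c ∈ K` row against the surplus of `Sigma_nonneg` (census: the row alone
  is negative on 67–85 / 300 instances, P4-G6-OU.md §3).
-/

namespace Summit.Ventures.PercRepro2

open UnionCluster CovForm

namespace RootLeafU

variable {V : Type*} {E : Type*} [Fintype E] [DecidableEq E] [Fintype V] [DecidableEq V]
  {R : Type*} [Field R] [LinearOrder R] [IsStrictOrderedRing R]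

section Helpers

variable (ends : E → Sym2 V)

omit [Fintype E] [DecidableEq E] [Fintype V] [DecidableEq V] in
/-- Connection events are symmetric. -/
lemma connEvent_comm (u v : V) : connEvent ends u v = connEvent ends v u := by
  ext ω
  exact ⟨fun h => conn_symm h, fun h => conn_symm h⟩

omit [Fintype E] [DecidableEq E] [Fintype V] [DecidableEq V] in
/-- `{u ↔ u}` is everything (local copy of RootLeafUOu's `connEvent_self`). -/
lemma connEvent_self' (u : V) : connEvent ends u u = Set.univ :=
  Set.eq_univ_of_forall fun ω => conn_refl ends ω u

omit [Fintype E] [DecidableEq E] [Fintype V] [DecidableEq V] in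
/-- `{s ↮ X}` is a decreasing event (local copy of RootLeafUOu's `isLowerSet_avoidAll_finset`). -/
lemma isLowerSet_avoidAll' (s : V) (X : Finset V) : IsLowerSet (avoidAll ends s X) := by
  intro ω ω' hle hω x hx hc
  exact hω x hx (conn_mono hle hc)

end Helpers

section Signs

variable (p : E → R) (ends : E → Sym2 V) (o a₂ c b u : V)

omit [DecidableEq V] in
/-- **`P(T′, b ∈ K) ≤ hb · t′`**: BHK06 Thm 1.4 (`c ∈ C(u)` against `b ∈ C(a₂)` on `u ↮ a₂`)
and Harris (`P(Q, bK) ≤ Z·hb`). -/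
lemma prob_Tp_bK_le (hp : IsProbVec p) :
    prob p (TEvent ends a₂ u c ∩ connEvent ends a₂ b) ≤
      prob p (connEvent ends a₂ b) * prob p (TEvent ends a₂ u c) := by
  classical
  have hU : IsUpperSet ({W : Set V | c ∈ W}) := fun _ _ h hc => h hc
  have hV : IsUpperSet ({W : Set V | b ∈ W}) := fun _ _ h hb => h hb
  have key := bhk_cross_cluster p hp ends u a₂ hU hV
  rw [ExploreA3.clusterInEvent_mem_eq, ExploreA3.clusterInEvent_mem_eq] at key
  -- the events
  have e1 : connEvent ends u c ∩ connEvent ends a₂ b ∩ (connEvent ends u a₂)ᶜ =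
      TEvent ends a₂ u c ∩ connEvent ends a₂ b := by
    ext ω; simp only [Set.mem_inter_iff, Set.mem_compl_iff, TEvent]; tauto
  have e2 : connEvent ends u c ∩ (connEvent ends u a₂)ᶜ = TEvent ends a₂ u c := by
    ext ω; simp only [Set.mem_inter_iff, Set.mem_compl_iff, TEvent]; tauto
  have e3 : connEvent ends a₂ b ∩ (connEvent ends u a₂)ᶜ =
      avoidAll ends a₂ {u} ∩ connEvent ends a₂ b := by
    rw [avoidAll_singleton_eq, connEvent_comm ends u a₂, Set.inter_comm]
  have e4 : (connEvent ends u a₂)ᶜ = avoidAll ends a₂ {u} := by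
    rw [avoidAll_singleton_eq, connEvent_comm ends u a₂]
  rw [e1, e2, e3, e4] at key
  -- Harris: `P(Q, bK) ≤ Z·hb`
  have hQ : IsLowerSet (avoidAll ends a₂ {u}) := isLowerSet_avoidAll' ends a₂ {u}
  have H1 := prob_inter_le_prob_mul_prob_of_isLowerSet hp hQ (isUpperSet_connEvent ends a₂ b)
  have nZ := prob_nonneg hp (avoidAll ends a₂ {u})
  have nT := prob_nonneg hp (TEvent ends a₂ u c)
  have nTb := prob_nonneg hp (TEvent ends a₂ u c ∩ connEvent ends a₂ b)
  have nhb := prob_nonneg hp (connEvent ends a₂ b)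
  rcases eq_or_lt_of_le nZ with hZ0 | hZpos
  · -- `Z = 0`: the `Q`-masses vanish
    have hsub : TEvent ends a₂ u c ∩ connEvent ends a₂ b ⊆ avoidAll ends a₂ {u} := by
      intro ω hω
      rw [← e4]
      exact hω.1.1
    have h0 : prob p (TEvent ends a₂ u c ∩ connEvent ends a₂ b) ≤ 0 := by
      have := prob_mono hp hsub
      linarith
    have : prob p (TEvent ends a₂ u c ∩ connEvent ends a₂ b) = 0 := le_antisymm h0 nTb
    rw [this]
    exact mul_nonneg nhb nT
  · -- `Z > 0`: divide `P(T′,bK)·Z ≤ t′·P(Q,bK) ≤ t′·Z·hb` by `Z`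
    have h2 : prob p (TEvent ends a₂ u c ∩ connEvent ends a₂ b) * prob p (avoidAll ends a₂ {u}) ≤
        prob p (connEvent ends a₂ b) * prob p (TEvent ends a₂ u c) * prob p (avoidAll ends a₂ {u}) := by
      calc prob p (TEvent ends a₂ u c ∩ connEvent ends a₂ b) * prob p (avoidAll ends a₂ {u})
          ≤ prob p (TEvent ends a₂ u c) * prob p (avoidAll ends a₂ {u} ∩ connEvent ends a₂ b) := key
        _ ≤ prob p (TEvent ends a₂ u c) * (prob p (avoidAll ends a₂ {u}) * prob p (connEvent ends a₂ b)) :=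
          mul_le_mul_of_nonneg_left H1 nT
        _ = prob p (connEvent ends a₂ b) * prob p (TEvent ends a₂ u c) * prob p (avoidAll ends a₂ {u}) := by ring
    exact le_of_mul_le_mul_right h2 hZpos

/-- **`B = α − κ ≤ 0`**: `B/2 = P(T′, bK) − hb·t′ − P(Q, bL, c ∉ K)` and `P(T′, bK) ≤ hb·t′`. -/
theorem B_nonpos (hp : IsProbVec p) :
    prob p (PDEvent ends u a₂ c) * prob p (connEvent ends a₂ b) +
        prob p (avoidAll ends a₂ {c}) * gap p ends u a₂ b -
      (prob p Set.univ * EQb3 p ends u a₂ c b + prob p Set.univ * PDb p ends u a₂ c b +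
        prob p (connEvent ends a₂ b) * EQ3 p ends u a₂ c +
        prob p (connEvent ends a₂ b) * prob p (avoidAll ends a₂ {u}) -
        (prob p Set.univ - prob p (avoidAll ends a₂ {c})) * gap p ends u a₂ b) ≤ 0 := by
  have hZ := Qsplit_univ p ends u a₂ c
  have hbK := Qsplit p ends u a₂ c (connEvent ends a₂ b)
  have hbL := Qsplit p ends u a₂ c (connEvent ends u b)
  have hgap := gap_eq_Q p ends u a₂ b
  have h1 := prob_Tp_bK_le p ends a₂ c b u hp
  have n1 := prob_nonneg hp (PDEvent ends u a₂ c ∩ connEvent ends u b)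
  have n2 := prob_nonneg hp (TEvent ends a₂ u c ∩ connEvent ends u b)
  unfold EQb3 PDb EQ3
  rw [prob_univ, hgap, hZ, hbK, hbL]
  nlinarith [h1, n1, n2]

omit [Fintype V] in
/-- **The mirror core vanishes**: the `o ∈ K` half of the second coefficient at `o := a₂` is `0`
(every `Q`-configuration has `o ∈ K`; the world-0 mass `e0` becomes `d0`). -/
theorem T2oK_root_eq_zero : T2oK p ends a₂ a₂ c b u = 0 := by
  have hZ := Qsplit_univ p ends u a₂ c
  have hbK := Qsplit p ends u a₂ c (connEvent ends a₂ b)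
  have hbL := Qsplit p ends u a₂ c (connEvent ends u b)
  have hgap := gap_eq_Q p ends u a₂ b
  unfold T2oK Ee EQb3 PDb EQ3
  rw [connEvent_self']
  simp only [Set.inter_univ, Set.univ_inter, prob_univ]
  rw [hgap, hZ, hbK, hbL]
  ring

end Signs

section Domination

variable (p : E → R) (ends : E → Sym2 V) (o a₂ c b u : V)

/-- **`P(T, b ∈ L) ≤ P(a₂ ↔ c) · P(R, b ∈ L)`** (the tower bound with the `L`-event `b ∈ L`). -/
lemma prob_T_bL_le (hp : IsProbVec p) :
    prob p (TEvent ends u a₂ c ∩ connEvent ends u b) ≤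
      prob p (connEvent ends a₂ c) * prob p (avoidAll ends u {a₂, c} ∩ connEvent ends u b) := by
  classical
  have ha2 : a₂ ∈ ({a₂, c} : Finset V) := by simp
  have tB := prob_clusterIn_inter_avoid_eq_expect p ends u a₂ ha2 {W | b ∈ W} {W | c ∈ W}
  have t1 := prob_clusterIn_inter_avoid_eq_expect p ends u a₂ ha2 {W | b ∈ W} Set.univ
  have hg1 : ∀ K, delClusterProb p ends a₂ Set.univ K = 1 := delClusterProb_univ p ends a₂
  simp only [clusterInEvent_univ, Set.inter_univ, hg1, mul_one] at t1
  rw [ExploreA3.clusterInEvent_mem_eq, ExploreA3.clusterInEvent_mem_eq] at tB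
  rw [ExploreA3.clusterInEvent_mem_eq] at t1
  have e1 : connEvent ends u b ∩ connEvent ends a₂ c ∩ avoidAll ends u {a₂, c} =
      TEvent ends u a₂ c ∩ connEvent ends u b := by
    rw [Set.inter_assoc, conn_inter_R, Set.inter_comm]
  have e2 : connEvent ends u b ∩ avoidAll ends u {a₂, c} =
      avoidAll ends u {a₂, c} ∩ connEvent ends u b := Set.inter_comm _ _
  rw [e1] at tB
  rw [e2] at t1
  rw [tB, t1, ← expect_const_mul]
  refine expect_mono hp fun ω => ?_
  have h1 : delClusterProb p ends a₂ {W | c ∈ W} (cluster ends ω u) ≤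
      prob p (connEvent ends a₂ c) := delClusterProb_mem_le p ends hp a₂ c _
  have h2 : (0 : R) ≤ ({W : Set V | b ∈ W}).indicator 1 (cluster ends ω u) :=
    Set.indicator_apply_nonneg fun _ => zero_le_one
  have h3 : (0 : R) ≤ (avoidAll ends u {a₂, c}).indicator 1 ω :=
    Set.indicator_apply_nonneg fun _ => zero_le_one
  calc ({W : Set V | b ∈ W}).indicator 1 (cluster ends ω u) *
        delClusterProb p ends a₂ {W | c ∈ W} (cluster ends ω u) * (avoidAll ends u {a₂, c}).indicator 1 ω
      ≤ ({W : Set V | b ∈ W}).indicator 1 (cluster ends ω u) * prob p (connEvent ends a₂ c) *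
        (avoidAll ends u {a₂, c}).indicator 1 ω :=
        mul_le_mul_of_nonneg_right (mul_le_mul_of_nonneg_left h1 h2) h3
    _ = prob p (connEvent ends a₂ c) * (({W : Set V | b ∈ W}).indicator 1 (cluster ends ω u) *
        (avoidAll ends u {a₂, c}).indicator 1 ω) := by ring

/-- **`Σ ≥ 0`, cleared**: `2β·P(R, b ∈ K) ≤ A·W` with `A = α + κ`, `β = S·D + d0·Z`, `W = D + t`,
`P(R, bK) = P(PD, bK) + P(T, bK)`. -/
theorem Sigma_nonneg (hp : IsProbVec p) :
    2 * (prob p Set.univ * prob p (PDEvent ends u a₂ c) +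
          prob p (avoidAll ends a₂ {c}) * prob p (avoidAll ends a₂ {u})) *
        (prob p (PDEvent ends u a₂ c ∩ connEvent ends a₂ b) +
          prob p (TEvent ends u a₂ c ∩ connEvent ends a₂ b)) ≤
      ((prob p (PDEvent ends u a₂ c) * prob p (connEvent ends a₂ b) +
          prob p (avoidAll ends a₂ {c}) * gap p ends u a₂ b) +
        (prob p Set.univ * EQb3 p ends u a₂ c b + prob p Set.univ * PDb p ends u a₂ c b +
          prob p (connEvent ends a₂ b) * EQ3 p ends u a₂ c +
          prob p (connEvent ends a₂ b) * prob p (avoidAll ends a₂ {u}) -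
          (prob p Set.univ - prob p (avoidAll ends a₂ {c})) * gap p ends u a₂ b)) *
        (prob p (PDEvent ends u a₂ c) + prob p (TEvent ends u a₂ c)) := by
  classical
  have hZ := Qsplit_univ p ends u a₂ c
  have hbK := Qsplit p ends u a₂ c (connEvent ends a₂ b)
  have hbL := Qsplit p ends u a₂ c (connEvent ends u b)
  have hgap := gap_eq_Q p ends u a₂ b
  have hR : prob p (PDEvent ends u a₂ c) + prob p (TEvent ends u a₂ c) =
      prob p (avoidAll ends u {a₂, c}) := by
    have h := ISplit.prob_PD_add_T p ends u a₂ c Set.univ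
    simpa only [Set.inter_univ] using h
  have hRbK := ISplit.prob_PD_add_T p ends u a₂ c (connEvent ends a₂ b)
  have hRbL := ISplit.prob_PD_add_T p ends u a₂ c (connEvent ends u b)
  have hd0 : prob p (avoidAll ends a₂ {c}) = 1 - prob p (connEvent ends a₂ c) := by
    rw [avoidAll_singleton_eq, prob_compl]
  -- the four pieces
  have hRl : IsLowerSet (avoidAll ends u {a₂, c}) := isLowerSet_avoidAll' ends u {a₂, c}
  have H3 := prob_inter_le_prob_mul_prob_of_isLowerSet hp hRl (isUpperSet_connEvent ends a₂ b)
  have H4 := prob_T_bL_le p ends a₂ c b u hp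
  have H6 := prob_Tp_bK_le p ends a₂ c b u hp
  have nD := prob_nonneg hp (PDEvent ends u a₂ c)
  have nTp := prob_nonneg hp (TEvent ends a₂ u c)
  have nTpbL := prob_nonneg hp (TEvent ends a₂ u c ∩ connEvent ends u b)
  have nd0 := prob_nonneg hp (avoidAll ends a₂ {c})
  have npc := prob_nonneg hp (connEvent ends a₂ c)
  have nW := prob_nonneg hp (avoidAll ends u {a₂, c})
  -- `W·hb − P(R,bK) ≥ 0`, `W·hb − d0·P(R,bK) ≥ 0`, `hb·t′ − P(T′,bK) ≥ 0`, `P(a₂↔c)·P(R,bL) − P(T,bL) ≥ 0`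
  have f1 : 0 ≤ prob p (avoidAll ends u {a₂, c}) * prob p (connEvent ends a₂ b) -
      prob p (avoidAll ends u {a₂, c} ∩ connEvent ends a₂ b) := by linarith
  have f3 : 0 ≤ prob p (connEvent ends a₂ b) * prob p (TEvent ends a₂ u c) -
      prob p (TEvent ends a₂ u c ∩ connEvent ends a₂ b) := by linarith
  have f4 : 0 ≤ prob p (connEvent ends a₂ c) * prob p (avoidAll ends u {a₂, c} ∩ connEvent ends u b) -
      prob p (TEvent ends u a₂ c ∩ connEvent ends u b) := by linarith
  have g1 := mul_nonneg f1 nD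
  have g2 := mul_nonneg (mul_nonneg nd0 f1) nTp
  have g3 := mul_nonneg (mul_nonneg npc nW) f3
  have g4 := mul_nonneg (mul_nonneg npc nW) nTpbL
  have g5 := mul_nonneg nW f4
  -- the identity `A·W/2 − β·P(R,bK) = f1·D + d0·f1·t′ + P(a₂↔c)·W·(f3 + P(T′,bL)) + W·f4`
  rw [← hR, ← hRbK] at g1
  rw [← hR, ← hRbK, hd0] at g2
  rw [← hR] at g3
  rw [← hR] at g4
  rw [← hR, ← hRbL] at g5
  unfold EQb3 PDb EQ3
  rw [prob_univ, hgap, hZ, hbK, hbL, hd0]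
  nlinarith [g1, g2, g3, g4, g5]


/-- **The negative term of `T2oL` is dominated by its `A`-term**:
`2β·[P(PD, oL, bK) + P(T, oL, bK)] ≤ A·[P(PD, oL) + P(T, oL)]` — BHK06 Thm 1.4 with the avoided
set `{a₂, c}` (`bhk_cross_cluster_avoid`, `s = u`, `𝓤 = {o ∈ ·}`, `𝓥 = {b ∈ ·}`) and `Sigma_nonneg`. -/
theorem negterm_le (hp : IsProbVec p) :
    2 * (prob p Set.univ * prob p (PDEvent ends u a₂ c) +
          prob p (avoidAll ends a₂ {c}) * prob p (avoidAll ends a₂ {u})) *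
        (prob p (PDEvent ends u a₂ c ∩ (connEvent ends u o ∩ connEvent ends a₂ b)) +
          prob p (TEvent ends u a₂ c ∩ (connEvent ends u o ∩ connEvent ends a₂ b))) ≤
      ((prob p (PDEvent ends u a₂ c) * prob p (connEvent ends a₂ b) +
          prob p (avoidAll ends a₂ {c}) * gap p ends u a₂ b) +
        (prob p Set.univ * EQb3 p ends u a₂ c b + prob p Set.univ * PDb p ends u a₂ c b +
          prob p (connEvent ends a₂ b) * EQ3 p ends u a₂ c +
          prob p (connEvent ends a₂ b) * prob p (avoidAll ends a₂ {u}) -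
          (prob p Set.univ - prob p (avoidAll ends a₂ {c})) * gap p ends u a₂ b)) *
        (prob p (PDEvent ends u a₂ c ∩ connEvent ends u o) +
          prob p (TEvent ends u a₂ c ∩ connEvent ends u o)) := by
  classical
  have ha2 : a₂ ∈ ({a₂, c} : Finset V) := by simp
  have hU : IsUpperSet ({W : Set V | o ∈ W}) := fun _ _ h ho => h ho
  have hV : IsUpperSet ({W : Set V | b ∈ W}) := fun _ _ h hb => h hb
  have key := bhk_cross_cluster_avoid p hp ends u a₂ ha2 hU hV
  rw [ExploreA3.clusterInEvent_mem_eq, ExploreA3.clusterInEvent_mem_eq] at key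
  have sN := ISplit.prob_PD_add_T p ends u a₂ c (connEvent ends u o ∩ connEvent ends a₂ b)
  have sY := ISplit.prob_PD_add_T p ends u a₂ c (connEvent ends u o)
  have sB := ISplit.prob_PD_add_T p ends u a₂ c (connEvent ends a₂ b)
  have hR : prob p (PDEvent ends u a₂ c) + prob p (TEvent ends u a₂ c) =
      prob p (avoidAll ends u {a₂, c}) := by
    have h := ISplit.prob_PD_add_T p ends u a₂ c Set.univ
    simpa only [Set.inter_univ] using h
  have e1 : connEvent ends u o ∩ connEvent ends a₂ b ∩ avoidAll ends u {a₂, c} =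
      avoidAll ends u {a₂, c} ∩ (connEvent ends u o ∩ connEvent ends a₂ b) := Set.inter_comm _ _
  have e2 : connEvent ends u o ∩ avoidAll ends u {a₂, c} =
      avoidAll ends u {a₂, c} ∩ connEvent ends u o := Set.inter_comm _ _
  have e3 : connEvent ends a₂ b ∩ avoidAll ends u {a₂, c} =
      avoidAll ends u {a₂, c} ∩ connEvent ends a₂ b := Set.inter_comm _ _
  rw [e1, e2, e3, ← sN, ← sY, ← sB, ← hR] at key
  have hS := Sigma_nonneg p ends a₂ c b u hp
  -- abbreviations
  set Neg := prob p (PDEvent ends u a₂ c ∩ (connEvent ends u o ∩ connEvent ends a₂ b)) +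
      prob p (TEvent ends u a₂ c ∩ (connEvent ends u o ∩ connEvent ends a₂ b)) with hNeg
  set Y := prob p (PDEvent ends u a₂ c ∩ connEvent ends u o) +
      prob p (TEvent ends u a₂ c ∩ connEvent ends u o) with hY
  set NbK := prob p (PDEvent ends u a₂ c ∩ connEvent ends a₂ b) +
      prob p (TEvent ends u a₂ c ∩ connEvent ends a₂ b) with hNbK
  set W := prob p (PDEvent ends u a₂ c) + prob p (TEvent ends u a₂ c) with hW
  set β := prob p Set.univ * prob p (PDEvent ends u a₂ c) +
      prob p (avoidAll ends a₂ {c}) * prob p (avoidAll ends a₂ {u}) with hβ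
  set A := (prob p (PDEvent ends u a₂ c) * prob p (connEvent ends a₂ b) +
      prob p (avoidAll ends a₂ {c}) * gap p ends u a₂ b) +
      (prob p Set.univ * EQb3 p ends u a₂ c b + prob p Set.univ * PDb p ends u a₂ c b +
        prob p (connEvent ends a₂ b) * EQ3 p ends u a₂ c +
        prob p (connEvent ends a₂ b) * prob p (avoidAll ends a₂ {u}) -
        (prob p Set.univ - prob p (avoidAll ends a₂ {c})) * gap p ends u a₂ b) with hA
  -- non-negativity
  have nβ : 0 ≤ β := by
    have := prob_nonneg hp (Set.univ : Set (Config E))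
    have := prob_nonneg hp (PDEvent ends u a₂ c)
    have := prob_nonneg hp (avoidAll ends a₂ {c})
    have := prob_nonneg hp (avoidAll ends a₂ {u})
    positivity
  have nY : 0 ≤ Y := by
    have := prob_nonneg hp (PDEvent ends u a₂ c ∩ connEvent ends u o)
    have := prob_nonneg hp (TEvent ends u a₂ c ∩ connEvent ends u o)
    positivity
  have nNeg : 0 ≤ Neg := by
    have := prob_nonneg hp (PDEvent ends u a₂ c ∩ (connEvent ends u o ∩ connEvent ends a₂ b))
    have := prob_nonneg hp (TEvent ends u a₂ c ∩ (connEvent ends u o ∩ connEvent ends a₂ b))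
    positivity
  have nW : 0 ≤ W := by
    have := prob_nonneg hp (PDEvent ends u a₂ c)
    have := prob_nonneg hp (TEvent ends u a₂ c)
    positivity
  -- `2β·Neg·W ≤ 2β·Y·NbK ≤ Y·A·W`
  have h1 : 2 * β * Neg * W ≤ 2 * β * (Y * NbK) := by
    have := mul_le_mul_of_nonneg_left key (by linarith : (0 : R) ≤ 2 * β)
    linarith
  have h2 : 2 * β * (Y * NbK) ≤ Y * (A * W) := by
    have := mul_le_mul_of_nonneg_left hS nY
    linarith
  rcases eq_or_lt_of_le nW with hW0 | hWpos
  · -- `W = 0`: both masses vanish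
    have hNeg0 : Neg = 0 := by
      have hle : Neg ≤ W := by
        have := prob_mono hp (Set.inter_subset_left :
          avoidAll ends u {a₂, c} ∩ (connEvent ends u o ∩ connEvent ends a₂ b) ⊆ avoidAll ends u {a₂, c})
        linarith [sN, hR]
      linarith
    have hY0 : Y = 0 := by
      have hle : Y ≤ W := by
        have := prob_mono hp (Set.inter_subset_left :
          avoidAll ends u {a₂, c} ∩ connEvent ends u o ⊆ avoidAll ends u {a₂, c})
        linarith [sY, hR]
      linarith
    rw [hNeg0, hY0]
    simp
  · have h3 : 2 * β * Neg * W ≤ A * Y * W := by nlinarith [h1, h2]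
    exact le_of_mul_le_mul_right h3 hWpos

/-- **What is left of the sign `0 ≤ T2oL`**: `T2oL ≥ (α − κ)·P(T, oL) + 2β·P(T, oL, bL)` — the
`c ∈ K` row against the surplus of `negterm_le` (with `α − κ ≤ 0`, `B_nonpos`). -/
theorem T2oL_ge_cK_row (hp : IsProbVec p) :
    (prob p (PDEvent ends u a₂ c) * prob p (connEvent ends a₂ b) +
        prob p (avoidAll ends a₂ {c}) * gap p ends u a₂ b -
      (prob p Set.univ * EQb3 p ends u a₂ c b + prob p Set.univ * PDb p ends u a₂ c b +
        prob p (connEvent ends a₂ b) * EQ3 p ends u a₂ c +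
        prob p (connEvent ends a₂ b) * prob p (avoidAll ends a₂ {u}) -
        (prob p Set.univ - prob p (avoidAll ends a₂ {c})) * gap p ends u a₂ b)) *
      prob p (TEvent ends u a₂ c ∩ connEvent ends u o) +
    2 * (prob p Set.univ * prob p (PDEvent ends u a₂ c) +
          prob p (avoidAll ends a₂ {c}) * prob p (avoidAll ends a₂ {u})) *
      prob p (TEvent ends u a₂ c ∩ (connEvent ends u o ∩ connEvent ends u b)) ≤
    T2oL p ends o a₂ c b u := by
  have h := negterm_le p ends o a₂ c b u hp
  unfold T2oL
  linarith

end Domination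

end RootLeafU

end Summit.Ventures.PercRepro2
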